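import Summits.AnomalousDissipation.AnomalousDissipation.Theorems.SawtoothPulseCascadeK1LocalisedCascadeStripBlocksCTG
import Summits.AnomalousDissipation.AnomalousDissipation.Theorems.SawtoothPulseCascadeK1LocalisedCascadeRatioBlocksCTG
import Summits.AnomalousDissipation.AnomalousDissipation.Theorems.SawtoothPulseCascadeK1LocalisedCascadeStripBlocksCT

/-!
# K1loc — helper: THE FOUR WINDOW SHAPES ON DYADIC BLOCKS IN ALL-ORDERS CORNER-TRACE GRADE («CT-GEO» dyadic steps)

Helper file of the prover lane on the crux `K1LocalisedCascade` (stmt-AnomalousDissipation-19491), route `SawtoothPulseCascade`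
(S-D fibre ledger, corner-trace track; finding F-p1g9-1, memo v15).  `…StripBlocksCTG` / `…RatioBlocksCTG` on the DYADIC block
family `Λ_m = Λ₀2^m` with box trapezoids `L_m = ℓ2^m`, `R_m = r2^m` (so `r*` is the same on every block) and, for the ratio classes
(`u = 1`), the box window `vΛ_{m+1}` of the block top; every side condition of the family reduced to its `m = 0` instance; the finite
block sums `A, β*, ρ*, Z` stay as explicit hypotheses (discharged by `norm_num` in the numeric layer, where `N_j` is a numeral).
Statements: `strip_vstep_dyadicCTG_le` (S-V), `lowFibre_hstep_dyadicCTG_le` (T-H), `ratioClass_vstep_dyadicCTG_le` (O-V, A-V),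
`ratioClass_hstep_dyadicCTG_le` (C-H, B-H).  No definitions; no statement about the crux.
[cite: Grafakos2014, Prop. 3.1.2 (5), Prop. 3.2.7 (3)] [problem: turb]
-/

-- `Summit.<Summit>.<Problem>`: single-conjunct summit, the duplicate namespace segment is deliberate.
set_option linter.dupNamespace false

noncomputable section

namespace Summit.AnomalousDissipation.AnomalousDissipation.Theorems.SawtoothPulseCascade.K1Window

open MeasureTheory Set Filter Topology UnitAddTorus Function Complex Metric
open scoped Real ENNReal
open Literature.Analysis Literature.Analysis.FunctionSpaces Literature.Analysis.FunctionSpaces.Torus Literature.Analysis.FluidPDE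
open Literature.Analysis.FluidPDE.ShearStage
open Literature.Analysis.FluidPDE.SawtoothCascade Literature.Analysis.FluidPDE.SawtoothCascade.CascadeParams
open Summit.AnomalousDissipation.AnomalousDissipation.Theorems.SawtoothPulseCascade.K1Start
open Summit.AnomalousDissipation.AnomalousDissipation.Theorems.SawtoothPulseCascade.K1Flat
open Summit.AnomalousDissipation.AnomalousDissipation.Theorems.SawtoothPulseCascade.K1Ledger.From

section Cascade

variable (P : CascadeParams)

set_option maxHeartbeats 800000 in
/-- Dyadic-block instantiation (`Λ_m = Λ₀2^m`, `L_m = ℓ2^m`, `R_m = r2^m`) of `tsum_strip_vstep_blocks_ctg_le`; the finite block sums stay as hypotheses for the numeric layer. [cite: Grafakos2014, Prop. 3.1.2 (5), Prop. 3.2.7 (3)] -/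
theorem strip_vstep_dyadicCTG_le {G : ℕ} (hγ : P.γ = G) (hδ₀ : 0 < P.δ₀) (hd : 0 < P.d) (hN₀ : 1 ≤ P.N₀)
    (hρN : 1 ≤ P.ρN) (a b : ℕ → UnitAddTorus (Fin 2) → ℝ) (has : ∀ j, IsSmooth (a j)) (h0 : a 0 = datum)
    (hb : ∀ j, b j = a j ∘ shearMap 0 1 (amp ⟨P.U j, P.U_periodic j, P.contDiff_U (P.δ_pos hδ₀ hd j)⟩ P.γ))
    (hab : ∀ j, a (j + 1) = b j ∘ shearMap 1 0 (amp ⟨P.U j, P.U_periodic j, P.contDiff_U (P.δ_pos hδ₀ hd j)⟩ P.γ))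
    (j : ℕ) (K : ℕ) (Λ0 : ℕ) (hΛ0 : 1 ≤ Λ0) (Mb : ℕ)
    (ℓ r : ℕ) (hr : 0 < r) (hℓr : 2 ≤ ℓ + r) (hΛQ : K + (ℓ + r) < Λ0 * G)
    {po : ℕ} (hp : 1 ≤ po) {εg : ℝ} (hεg : 0 < εg)
    {M ε : ℝ} (hM : 1 ≤ M) (hMδ : M * P.δ j < π / 2) (hε : Real.exp (-(M ^ 2 / 2)) ≤ ε)
    {u' v' Y : ℕ} (hfeed : u' * (Λ0 * 2) ≤ v' * ℓ) (hY : Y ≤ ℓ + 1)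
    {A βs ρs Z : ℝ} (hβs : 0 ≤ βs) (hρs : 0 ≤ ρs)
    (hA : ∑ m ∈ Finset.range Mb, (1 + εg) * ((P.N j : ℝ) ^ 2 / π ^ 2) *
              (8 * (((Λ0 * 2 ^ m : ℕ) : ℝ) * G - (((ℓ * 2 ^ m + r * 2 ^ m : ℕ) : ℝ) - 1)) ^ 2 / ((((Λ0 * 2 ^ m : ℕ) : ℝ) * G - (((ℓ * 2 ^ m + r * 2 ^ m : ℕ) : ℝ) - 1)) ^ 2 - (K : ℝ) ^ 2) ^ 2 +
                8 * ((K : ℝ) + 1 / 2) / (P.N j * ((((Λ0 * 2 ^ m : ℕ) : ℝ) * G - (((ℓ * 2 ^ m + r * 2 ^ m : ℕ) : ℝ) - 1)) ^ 2 - ((K : ℝ) + 1 / 2) ^ 2))) *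
              ((Real.sqrt ((2 * (ℓ * 2 ^ m) + r * 2 ^ m : ℕ) * ((r * 2 ^ m : ℕ) : ℝ)) / ((r * 2 ^ m : ℕ) : ℝ) * 1) ^ 2 / 2 + (Real.sqrt ((2 * (ℓ * 2 ^ m) + r * 2 ^ m : ℕ) * ((r * 2 ^ m : ℕ) : ℝ)) / ((r * 2 ^ m : ℕ) : ℝ) * 1) ^ 2 / 2) ≤ A)
    (hβ : ∀ m ∈ Finset.range Mb, (1 + εg⁻¹) * ((P.N j : ℝ) ^ 2 / π ^ 2) * (4 / (((Λ0 * 2 ^ m * G - K - (ℓ * 2 ^ m + r * 2 ^ m) : ℕ) : ℝ)) ^ 2 *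
              (1 / ((((Λ0 * 2 ^ m * G - K - (ℓ * 2 ^ m + r * 2 ^ m) : ℕ) : ℝ)) + ((ℓ * 2 ^ m + r * 2 ^ m : ℕ) : ℝ)) ^ (2 * po) +
                1 / (P.N j * ((((Λ0 * 2 ^ m * G - K - (ℓ * 2 ^ m + r * 2 ^ m) : ℕ) : ℝ)) + ((ℓ * 2 ^ m + r * 2 ^ m : ℕ) : ℝ)) ^ (2 * po - 1)))) *
              ((2 * ((ℓ * 2 ^ m + r * 2 ^ m : ℕ) : ℝ) / P.N j + 1) * ((ℓ * 2 ^ m + r * 2 ^ m : ℕ) : ℝ) ^ (2 * po)) ≤ βs)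
    (hρ : ∀ m ∈ Finset.range Mb, (π * ((Λ0 * 2 ^ (m + 1) * G : ℕ) : ℝ) * ε / P.N j) ^ 2 ≤ ρs)
    (hZ : ∑ m ∈ Finset.range Mb, 8 * M * P.δ j / π * ((Real.sqrt ((2 * (ℓ * 2 ^ m) + r * 2 ^ m : ℕ) * ((r * 2 ^ m : ℕ) : ℝ)) / ((r * 2 ^ m : ℕ) : ℝ) * 1) ^ 2 / 2 +
        (Real.sqrt ((2 * (ℓ * 2 ^ m) + r * 2 ^ m : ℕ) * ((r * 2 ^ m : ℕ) : ℝ)) / ((r * 2 ^ m : ℕ) : ℝ) * 1) ^ 2 / 2) ≤ Z) :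
    ∑' k : Fin 2 → ℤ, (if |k 0| < (K : ℤ) then (1 : ℝ) else 0) * ‖mFourierCoeff (fun x => (a (j + 1) x : ℂ)) k‖ ^ 2 ≤
      ∑' k : Fin 2 → ℤ, (if |k 1| < ((Λ0 * 2 ^ 0 : ℕ) : ℤ) then (1 : ℝ) else 0) * ‖mFourierCoeff (fun x => (b j x : ℂ)) k‖ ^ 2 +
      ((Real.sqrt (A + βs / 2) + Real.sqrt (ρs / 2 + Z) +
          Real.sqrt (∑' k : Fin 2 → ℤ, (if (Y : ℤ) ≤ |k 0| ∧ (u' : ℤ) * |k 1| ≤ (v' : ℤ) * |k 0| then (1 : ℝ) else 0) *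
            ‖mFourierCoeff (fun x => (b j x : ℂ)) k‖ ^ 2)) ^ 2 +
        ((1 + P.γ) ^ (2 * (j + 1)) / ((Λ0 * 2 ^ Mb : ℕ) : ℝ)) ^ 2) := by
  have hmono : Monotone (fun m : ℕ => Λ0 * 2 ^ m) := fun m n h => Nat.mul_le_mul_left _ (Nat.pow_le_pow_right (by norm_num) h)
  have hΛ0' : 1 ≤ (fun m : ℕ => Λ0 * 2 ^ m) 0 := by simpa using hΛ0
  have hR' : ∀ m : ℕ, 0 < (fun m : ℕ => r * 2 ^ m) m := fun m => Nat.mul_pos hr (Nat.two_pow_pos m)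
  have hLR' : ∀ m : ℕ, 2 ≤ (fun m : ℕ => ℓ * 2 ^ m) m + (fun m : ℕ => r * 2 ^ m) m := fun m => by
    have h2 : 1 ≤ 2 ^ m := Nat.one_le_two_pow
    show 2 ≤ ℓ * 2 ^ m + r * 2 ^ m
    nlinarith
  have hΛQ' : ∀ m : ℕ, K + ((fun m : ℕ => ℓ * 2 ^ m) m + (fun m : ℕ => r * 2 ^ m) m) < (fun m : ℕ => Λ0 * 2 ^ m) m * G :=
    fun m => by
    have h2 : 1 ≤ 2 ^ m := Nat.one_le_two_pow
    have h3 := Nat.mul_le_mul_right (2 ^ m) (Nat.succ_le_of_lt hΛQ)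
    show K + (ℓ * 2 ^ m + r * 2 ^ m) < Λ0 * 2 ^ m * G
    nlinarith
  have hfeed' : ∀ m : ℕ, u' * (fun m : ℕ => Λ0 * 2 ^ m) (m + 1) ≤ v' * ((fun m : ℕ => ℓ * 2 ^ m) m + 1) := fun m => by
    show u' * (Λ0 * 2 ^ (m + 1)) ≤ v' * (ℓ * 2 ^ m + 1)
    have h := Nat.mul_le_mul_right (2 ^ m) hfeed
    rw [pow_succ]
    nlinarith
  have hY' : ∀ m : ℕ, Y ≤ (fun m : ℕ => ℓ * 2 ^ m) m + 1 := fun m => by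
    have h2 : 1 ≤ 2 ^ m := Nat.one_le_two_pow
    show Y ≤ ℓ * 2 ^ m + 1
    nlinarith
  exact tsum_strip_vstep_blocks_ctg_le P hγ hδ₀ hd hN₀ hρN a b has h0 hb hab j K _ hmono hΛ0' Mb _ _ hR' hLR' hΛQ' hp hεg hM hMδ hε
    hfeed' hY' hβs hρs hA hβ hρ hZ

set_option maxHeartbeats 800000 in
/-- Dyadic-block instantiation (`Λ_m = Λ₀2^m`, `L_m = ℓ2^m`, `R_m = r2^m`) of `tsum_lowFibre_hstep_blocks_ctg_le`; the finite block sums stay as hypotheses for the numeric layer. [cite: Grafakos2014, Prop. 3.1.2 (5), Prop. 3.2.7 (3)] -/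
theorem lowFibre_hstep_dyadicCTG_le {G : ℕ} (hγ : P.γ = G) (hδ₀ : 0 < P.δ₀) (hd : 0 < P.d) (hN₀ : 1 ≤ P.N₀)
    (hρN : 1 ≤ P.ρN) (a b : ℕ → UnitAddTorus (Fin 2) → ℝ) (has : ∀ j, IsSmooth (a j)) (h0 : a 0 = datum)
    (hb : ∀ j, b j = a j ∘ shearMap 0 1 (amp ⟨P.U j, P.U_periodic j, P.contDiff_U (P.δ_pos hδ₀ hd j)⟩ P.γ))
    (hab : ∀ j, a (j + 1) = b j ∘ shearMap 1 0 (amp ⟨P.U j, P.U_periodic j, P.contDiff_U (P.δ_pos hδ₀ hd j)⟩ P.γ))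
    (j : ℕ) (K : ℕ) (Λ0 : ℕ) (hΛ0 : 1 ≤ Λ0) (Mb : ℕ)
    (ℓ r : ℕ) (hr : 0 < r) (hℓr : 2 ≤ ℓ + r) (hΛQ : K + (ℓ + r) < Λ0 * G)
    {po : ℕ} (hp : 1 ≤ po) {εg : ℝ} (hεg : 0 < εg)
    {M ε : ℝ} (hM : 1 ≤ M) (hMδ : M * P.δ j < π / 2) (hε : Real.exp (-(M ^ 2 / 2)) ≤ ε)
    {u' v' : ℕ} (hfeed : u' * (Λ0 * 2) ≤ v' * ℓ)
    {A βs ρs Z : ℝ} (hβs : 0 ≤ βs) (hρs : 0 ≤ ρs)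
    (hA : ∑ m ∈ Finset.range Mb, (1 + εg) * ((P.N j : ℝ) ^ 2 / π ^ 2) *
              (8 * (((Λ0 * 2 ^ m : ℕ) : ℝ) * G - (((ℓ * 2 ^ m + r * 2 ^ m : ℕ) : ℝ) - 1)) ^ 2 / ((((Λ0 * 2 ^ m : ℕ) : ℝ) * G - (((ℓ * 2 ^ m + r * 2 ^ m : ℕ) : ℝ) - 1)) ^ 2 - (K : ℝ) ^ 2) ^ 2 +
                8 * ((K : ℝ) + 1 / 2) / (P.N j * ((((Λ0 * 2 ^ m : ℕ) : ℝ) * G - (((ℓ * 2 ^ m + r * 2 ^ m : ℕ) : ℝ) - 1)) ^ 2 - ((K : ℝ) + 1 / 2) ^ 2))) *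
              ((Real.sqrt ((2 * (ℓ * 2 ^ m) + r * 2 ^ m : ℕ) * ((r * 2 ^ m : ℕ) : ℝ)) / ((r * 2 ^ m : ℕ) : ℝ) * 1) ^ 2 / 2 + (Real.sqrt ((2 * (ℓ * 2 ^ m) + r * 2 ^ m : ℕ) * ((r * 2 ^ m : ℕ) : ℝ)) / ((r * 2 ^ m : ℕ) : ℝ) * 1) ^ 2 / 2) ≤ A)
    (hβ : ∀ m ∈ Finset.range Mb, (1 + εg⁻¹) * ((P.N j : ℝ) ^ 2 / π ^ 2) * (4 / (((Λ0 * 2 ^ m * G - K - (ℓ * 2 ^ m + r * 2 ^ m) : ℕ) : ℝ)) ^ 2 *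
              (1 / ((((Λ0 * 2 ^ m * G - K - (ℓ * 2 ^ m + r * 2 ^ m) : ℕ) : ℝ)) + ((ℓ * 2 ^ m + r * 2 ^ m : ℕ) : ℝ)) ^ (2 * po) +
                1 / (P.N j * ((((Λ0 * 2 ^ m * G - K - (ℓ * 2 ^ m + r * 2 ^ m) : ℕ) : ℝ)) + ((ℓ * 2 ^ m + r * 2 ^ m : ℕ) : ℝ)) ^ (2 * po - 1)))) *
              ((2 * ((ℓ * 2 ^ m + r * 2 ^ m : ℕ) : ℝ) / P.N j + 1) * ((ℓ * 2 ^ m + r * 2 ^ m : ℕ) : ℝ) ^ (2 * po)) ≤ βs)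
    (hρ : ∀ m ∈ Finset.range Mb, (π * ((Λ0 * 2 ^ (m + 1) * G : ℕ) : ℝ) * ε / P.N j) ^ 2 ≤ ρs)
    (hZ : ∑ m ∈ Finset.range Mb, 8 * M * P.δ j / π * ((Real.sqrt ((2 * (ℓ * 2 ^ m) + r * 2 ^ m : ℕ) * ((r * 2 ^ m : ℕ) : ℝ)) / ((r * 2 ^ m : ℕ) : ℝ) * 1) ^ 2 / 2 +
        (Real.sqrt ((2 * (ℓ * 2 ^ m) + r * 2 ^ m : ℕ) * ((r * 2 ^ m : ℕ) : ℝ)) / ((r * 2 ^ m : ℕ) : ℝ) * 1) ^ 2 / 2) ≤ Z) :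
    ∑' k : Fin 2 → ℤ, (if |k 1| < (K : ℤ) then (1 : ℝ) else 0) * ‖mFourierCoeff (fun x => (b j x : ℂ)) k‖ ^ 2 ≤
      ∑' k : Fin 2 → ℤ, (if |k 0| < ((Λ0 * 2 ^ 0 : ℕ) : ℤ) then (1 : ℝ) else 0) * ‖mFourierCoeff (fun x => (a j x : ℂ)) k‖ ^ 2 +
      ((Real.sqrt (A + βs / 2) + Real.sqrt (ρs / 2 + Z) +
          Real.sqrt (∑' k : Fin 2 → ℤ, (if ((Λ0 * 2 ^ 0 : ℕ) : ℤ) ≤ |k 0| ∧ (u' : ℤ) * |k 0| ≤ (v' : ℤ) * |k 1| then (1 : ℝ) else 0) *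
            ‖mFourierCoeff (fun x => (a j x : ℂ)) k‖ ^ 2)) ^ 2 +
        ((1 + P.γ) ^ (2 * j) / ((Λ0 * 2 ^ Mb : ℕ) : ℝ)) ^ 2) := by
  have hmono : Monotone (fun m : ℕ => Λ0 * 2 ^ m) := fun m n h => Nat.mul_le_mul_left _ (Nat.pow_le_pow_right (by norm_num) h)
  have hΛ0' : 1 ≤ (fun m : ℕ => Λ0 * 2 ^ m) 0 := by simpa using hΛ0
  have hR' : ∀ m : ℕ, 0 < (fun m : ℕ => r * 2 ^ m) m := fun m => Nat.mul_pos hr (Nat.two_pow_pos m)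
  have hLR' : ∀ m : ℕ, 2 ≤ (fun m : ℕ => ℓ * 2 ^ m) m + (fun m : ℕ => r * 2 ^ m) m := fun m => by
    have h2 : 1 ≤ 2 ^ m := Nat.one_le_two_pow
    show 2 ≤ ℓ * 2 ^ m + r * 2 ^ m
    nlinarith
  have hΛQ' : ∀ m : ℕ, K + ((fun m : ℕ => ℓ * 2 ^ m) m + (fun m : ℕ => r * 2 ^ m) m) < (fun m : ℕ => Λ0 * 2 ^ m) m * G :=
    fun m => by
    have h2 : 1 ≤ 2 ^ m := Nat.one_le_two_pow
    have h3 := Nat.mul_le_mul_right (2 ^ m) (Nat.succ_le_of_lt hΛQ)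
    show K + (ℓ * 2 ^ m + r * 2 ^ m) < Λ0 * 2 ^ m * G
    nlinarith
  have hfeed' : ∀ m : ℕ, u' * (fun m : ℕ => Λ0 * 2 ^ m) (m + 1) ≤ v' * ((fun m : ℕ => ℓ * 2 ^ m) m + 1) := fun m => by
    show u' * (Λ0 * 2 ^ (m + 1)) ≤ v' * (ℓ * 2 ^ m + 1)
    have h := Nat.mul_le_mul_right (2 ^ m) hfeed
    rw [pow_succ]
    nlinarith
  exact tsum_lowFibre_hstep_blocks_ctg_le P hγ hδ₀ hd hN₀ hρN a b has h0 hb hab j K _ hmono hΛ0' Mb _ _ hR' hLR' hΛQ' hp hεg hM hMδ hε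
    hfeed' hβs hρs hA hβ hρ hZ

set_option maxHeartbeats 800000 in
/-- Dyadic-block instantiation (`Λ_m = Λ₀2^m`, `L_m = ℓ2^m`, `R_m = r2^m`) of `tsum_ratioClass_vstep_blocks_ctg_le`; the finite block sums stay as hypotheses for the numeric layer. [cite: Grafakos2014, Prop. 3.1.2 (5), Prop. 3.2.7 (3)] -/
theorem ratioClass_vstep_dyadicCTG_le {G : ℕ} (hγ : P.γ = G) (hδ₀ : 0 < P.δ₀) (hd : 0 < P.d) (hN₀ : 1 ≤ P.N₀)
    (hρN : 1 ≤ P.ρN) (a b : ℕ → UnitAddTorus (Fin 2) → ℝ) (has : ∀ j, IsSmooth (a j)) (h0 : a 0 = datum)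
    (hb : ∀ j, b j = a j ∘ shearMap 0 1 (amp ⟨P.U j, P.U_periodic j, P.contDiff_U (P.δ_pos hδ₀ hd j)⟩ P.γ))
    (hab : ∀ j, a (j + 1) = b j ∘ shearMap 1 0 (amp ⟨P.U j, P.U_periodic j, P.contDiff_U (P.δ_pos hδ₀ hd j)⟩ P.γ))
    (j : ℕ) {v X : ℕ} (hv : 0 < v)
    (Λ0 : ℕ) (hΛ0 : 1 ≤ Λ0) (Mb : ℕ) (hΛX : v * Λ0 ≤ X)
    (ℓ r : ℕ) (hr : 0 < r) (hℓr : 2 ≤ ℓ + r)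
    (hΛQ : 2 * v * Λ0 + (ℓ + r) + 1 ≤ Λ0 * G) {po : ℕ} (hp : 1 ≤ po) {εg : ℝ} (hεg : 0 < εg)
    {M ε : ℝ} (hM : 1 ≤ M) (hMδ : M * P.δ j < π / 2) (hε : Real.exp (-(M ^ 2 / 2)) ≤ ε)
    {u' v' Y : ℕ} (hfeed : u' * (Λ0 * 2) ≤ v' * ℓ) (hY : Y ≤ ℓ + 1)
    {A βs ρs Z : ℝ} (hβs : 0 ≤ βs) (hρs : 0 ≤ ρs)
    (hA : ∑ m ∈ Finset.range Mb, (1 + εg) * ((P.N j : ℝ) ^ 2 / π ^ 2) *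
              (8 * (((Λ0 * 2 ^ m : ℕ) : ℝ) * G - (((ℓ * 2 ^ m + r * 2 ^ m : ℕ) : ℝ) - 1)) ^ 2 / ((((Λ0 * 2 ^ m : ℕ) : ℝ) * G - (((ℓ * 2 ^ m + r * 2 ^ m : ℕ) : ℝ) - 1)) ^ 2 - ((v * (Λ0 * 2 ^ (m + 1)) / 1 : ℕ) : ℝ) ^ 2) ^ 2 +
                8 * (((v * (Λ0 * 2 ^ (m + 1)) / 1 : ℕ) : ℝ) + 1 / 2) / (P.N j * ((((Λ0 * 2 ^ m : ℕ) : ℝ) * G - (((ℓ * 2 ^ m + r * 2 ^ m : ℕ) : ℝ) - 1)) ^ 2 - (((v * (Λ0 * 2 ^ (m + 1)) / 1 : ℕ) : ℝ) + 1 / 2) ^ 2))) *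
              ((Real.sqrt ((2 * (ℓ * 2 ^ m) + r * 2 ^ m : ℕ) * ((r * 2 ^ m : ℕ) : ℝ)) / ((r * 2 ^ m : ℕ) : ℝ) * 1) ^ 2 / 2 + (Real.sqrt ((2 * (ℓ * 2 ^ m) + r * 2 ^ m : ℕ) * ((r * 2 ^ m : ℕ) : ℝ)) / ((r * 2 ^ m : ℕ) : ℝ) * 1) ^ 2 / 2) ≤ A)
    (hβ : ∀ m ∈ Finset.range Mb, (1 + εg⁻¹) * ((P.N j : ℝ) ^ 2 / π ^ 2) * (4 / (((Λ0 * 2 ^ m * G - v * (Λ0 * 2 ^ (m + 1)) / 1 - (ℓ * 2 ^ m + r * 2 ^ m) : ℕ) : ℝ)) ^ 2 *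
              (1 / ((((Λ0 * 2 ^ m * G - v * (Λ0 * 2 ^ (m + 1)) / 1 - (ℓ * 2 ^ m + r * 2 ^ m) : ℕ) : ℝ)) + ((ℓ * 2 ^ m + r * 2 ^ m : ℕ) : ℝ)) ^ (2 * po) +
                1 / (P.N j * ((((Λ0 * 2 ^ m * G - v * (Λ0 * 2 ^ (m + 1)) / 1 - (ℓ * 2 ^ m + r * 2 ^ m) : ℕ) : ℝ)) + ((ℓ * 2 ^ m + r * 2 ^ m : ℕ) : ℝ)) ^ (2 * po - 1)))) *
              ((2 * ((ℓ * 2 ^ m + r * 2 ^ m : ℕ) : ℝ) / P.N j + 1) * ((ℓ * 2 ^ m + r * 2 ^ m : ℕ) : ℝ) ^ (2 * po)) ≤ βs)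
    (hρ : ∀ m ∈ Finset.range Mb, (π * ((Λ0 * 2 ^ (m + 1) * G : ℕ) : ℝ) * ε / P.N j) ^ 2 ≤ ρs)
    (hZ : ∑ m ∈ Finset.range Mb, 8 * M * P.δ j / π * ((Real.sqrt ((2 * (ℓ * 2 ^ m) + r * 2 ^ m : ℕ) * ((r * 2 ^ m : ℕ) : ℝ)) / ((r * 2 ^ m : ℕ) : ℝ) * 1) ^ 2 / 2 +
        (Real.sqrt ((2 * (ℓ * 2 ^ m) + r * 2 ^ m : ℕ) * ((r * 2 ^ m : ℕ) : ℝ)) / ((r * 2 ^ m : ℕ) : ℝ) * 1) ^ 2 / 2) ≤ Z) :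
    ∑' k : Fin 2 → ℤ, (if (X : ℤ) ≤ |k 0| ∧ (1 : ℤ) * |k 0| ≤ (v : ℤ) * |k 1| then (1 : ℝ) else 0) *
        ‖mFourierCoeff (fun x => (a (j + 1) x : ℂ)) k‖ ^ 2 ≤
      (Real.sqrt (A + βs / 2) + Real.sqrt (ρs / 2 + Z) +
          Real.sqrt (∑' k : Fin 2 → ℤ, (if (Y : ℤ) ≤ |k 0| ∧ (u' : ℤ) * |k 1| ≤ (v' : ℤ) * |k 0| then (1 : ℝ) else 0) *
            ‖mFourierCoeff (fun x => (b j x : ℂ)) k‖ ^ 2)) ^ 2 +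
        ((1 + P.γ) ^ (2 * (j + 1)) / ((Λ0 * 2 ^ Mb : ℕ) : ℝ)) ^ 2 := by
  have hmono : Monotone (fun m : ℕ => Λ0 * 2 ^ m) := fun m n h => Nat.mul_le_mul_left _ (Nat.pow_le_pow_right (by norm_num) h)
  have hΛ0' : 1 ≤ (fun m : ℕ => Λ0 * 2 ^ m) 0 := by simpa using hΛ0
  have hR' : ∀ m : ℕ, 0 < (fun m : ℕ => r * 2 ^ m) m := fun m => Nat.mul_pos hr (Nat.two_pow_pos m)
  have hLR' : ∀ m : ℕ, 2 ≤ (fun m : ℕ => ℓ * 2 ^ m) m + (fun m : ℕ => r * 2 ^ m) m := fun m => by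
    have h2 : 1 ≤ 2 ^ m := Nat.one_le_two_pow
    show 2 ≤ ℓ * 2 ^ m + r * 2 ^ m
    nlinarith
  have hΛQ' : ∀ m : ℕ, v * (fun m : ℕ => Λ0 * 2 ^ m) (m + 1) / 1 + ((fun m : ℕ => ℓ * 2 ^ m) m + (fun m : ℕ => r * 2 ^ m) m) + 1 ≤
      (fun m : ℕ => Λ0 * 2 ^ m) m * G := fun m => by
    have h2 : 1 ≤ 2 ^ m := Nat.one_le_two_pow
    have h3 := Nat.mul_le_mul_right (2 ^ m) hΛQ
    show v * (Λ0 * 2 ^ (m + 1)) / 1 + (ℓ * 2 ^ m + r * 2 ^ m) + 1 ≤ Λ0 * 2 ^ m * G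
    rw [Nat.div_one, pow_succ]
    nlinarith
  have hfeed' : ∀ m : ℕ, u' * (fun m : ℕ => Λ0 * 2 ^ m) (m + 1) ≤ v' * ((fun m : ℕ => ℓ * 2 ^ m) m + 1) := fun m => by
    show u' * (Λ0 * 2 ^ (m + 1)) ≤ v' * (ℓ * 2 ^ m + 1)
    have h := Nat.mul_le_mul_right (2 ^ m) hfeed
    rw [pow_succ]
    nlinarith
  have hY' : ∀ m : ℕ, Y ≤ (fun m : ℕ => ℓ * 2 ^ m) m + 1 := fun m => by
    have h2 : 1 ≤ 2 ^ m := Nat.one_le_two_pow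
    show Y ≤ ℓ * 2 ^ m + 1
    nlinarith
  have hΛX' : v * (fun m : ℕ => Λ0 * 2 ^ m) 0 ≤ 1 * X := by simpa using hΛX
  exact tsum_ratioClass_vstep_blocks_ctg_le P hγ hδ₀ hd hN₀ hρN a b has h0 hb hab j Nat.one_pos hv _ hmono hΛ0' Mb hΛX' _ _ hR' hLR'
    hΛQ' hp hεg hM hMδ hε hfeed' hY' hβs hρs hA hβ hρ hZ

set_option maxHeartbeats 800000 in
/-- Dyadic-block instantiation (`Λ_m = Λ₀2^m`, `L_m = ℓ2^m`, `R_m = r2^m`) of `tsum_ratioClass_hstep_blocks_ctg_le`; the finite block sums stay as hypotheses for the numeric layer. [cite: Grafakos2014, Prop. 3.1.2 (5), Prop. 3.2.7 (3)] -/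
theorem ratioClass_hstep_dyadicCTG_le {G : ℕ} (hγ : P.γ = G) (hδ₀ : 0 < P.δ₀) (hd : 0 < P.d) (hN₀ : 1 ≤ P.N₀)
    (hρN : 1 ≤ P.ρN) (a b : ℕ → UnitAddTorus (Fin 2) → ℝ) (has : ∀ j, IsSmooth (a j)) (h0 : a 0 = datum)
    (hb : ∀ j, b j = a j ∘ shearMap 0 1 (amp ⟨P.U j, P.U_periodic j, P.contDiff_U (P.δ_pos hδ₀ hd j)⟩ P.γ))
    (hab : ∀ j, a (j + 1) = b j ∘ shearMap 1 0 (amp ⟨P.U j, P.U_periodic j, P.contDiff_U (P.δ_pos hδ₀ hd j)⟩ P.γ))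
    (j : ℕ) {v : ℕ} (hv : 0 < v)
    (Λ0 : ℕ) (hΛ0 : 1 ≤ Λ0) (Mb : ℕ)
    (ℓ r : ℕ) (hr : 0 < r) (hℓr : 2 ≤ ℓ + r)
    (hΛQ : 2 * v * Λ0 + (ℓ + r) + 1 ≤ Λ0 * G) {po : ℕ} (hp : 1 ≤ po) {εg : ℝ} (hεg : 0 < εg)
    {M ε : ℝ} (hM : 1 ≤ M) (hMδ : M * P.δ j < π / 2) (hε : Real.exp (-(M ^ 2 / 2)) ≤ ε)
    {u' v' Y : ℕ} (hfeed : u' * (Λ0 * 2) ≤ v' * ℓ) (hY : Y ≤ Λ0)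
    {A βs ρs Z : ℝ} (hβs : 0 ≤ βs) (hρs : 0 ≤ ρs)
    (hA : ∑ m ∈ Finset.range Mb, (1 + εg) * ((P.N j : ℝ) ^ 2 / π ^ 2) *
              (8 * (((Λ0 * 2 ^ m : ℕ) : ℝ) * G - (((ℓ * 2 ^ m + r * 2 ^ m : ℕ) : ℝ) - 1)) ^ 2 / ((((Λ0 * 2 ^ m : ℕ) : ℝ) * G - (((ℓ * 2 ^ m + r * 2 ^ m : ℕ) : ℝ) - 1)) ^ 2 - ((v * (Λ0 * 2 ^ (m + 1)) / 1 : ℕ) : ℝ) ^ 2) ^ 2 +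
                8 * (((v * (Λ0 * 2 ^ (m + 1)) / 1 : ℕ) : ℝ) + 1 / 2) / (P.N j * ((((Λ0 * 2 ^ m : ℕ) : ℝ) * G - (((ℓ * 2 ^ m + r * 2 ^ m : ℕ) : ℝ) - 1)) ^ 2 - (((v * (Λ0 * 2 ^ (m + 1)) / 1 : ℕ) : ℝ) + 1 / 2) ^ 2))) *
              ((Real.sqrt ((2 * (ℓ * 2 ^ m) + r * 2 ^ m : ℕ) * ((r * 2 ^ m : ℕ) : ℝ)) / ((r * 2 ^ m : ℕ) : ℝ) * 1) ^ 2 / 2 + (Real.sqrt ((2 * (ℓ * 2 ^ m) + r * 2 ^ m : ℕ) * ((r * 2 ^ m : ℕ) : ℝ)) / ((r * 2 ^ m : ℕ) : ℝ) * 1) ^ 2 / 2) ≤ A)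
    (hβ : ∀ m ∈ Finset.range Mb, (1 + εg⁻¹) * ((P.N j : ℝ) ^ 2 / π ^ 2) * (4 / (((Λ0 * 2 ^ m * G - v * (Λ0 * 2 ^ (m + 1)) / 1 - (ℓ * 2 ^ m + r * 2 ^ m) : ℕ) : ℝ)) ^ 2 *
              (1 / ((((Λ0 * 2 ^ m * G - v * (Λ0 * 2 ^ (m + 1)) / 1 - (ℓ * 2 ^ m + r * 2 ^ m) : ℕ) : ℝ)) + ((ℓ * 2 ^ m + r * 2 ^ m : ℕ) : ℝ)) ^ (2 * po) +
                1 / (P.N j * ((((Λ0 * 2 ^ m * G - v * (Λ0 * 2 ^ (m + 1)) / 1 - (ℓ * 2 ^ m + r * 2 ^ m) : ℕ) : ℝ)) + ((ℓ * 2 ^ m + r * 2 ^ m : ℕ) : ℝ)) ^ (2 * po - 1)))) *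
              ((2 * ((ℓ * 2 ^ m + r * 2 ^ m : ℕ) : ℝ) / P.N j + 1) * ((ℓ * 2 ^ m + r * 2 ^ m : ℕ) : ℝ) ^ (2 * po)) ≤ βs)
    (hρ : ∀ m ∈ Finset.range Mb, (π * ((Λ0 * 2 ^ (m + 1) * G : ℕ) : ℝ) * ε / P.N j) ^ 2 ≤ ρs)
    (hZ : ∑ m ∈ Finset.range Mb, 8 * M * P.δ j / π * ((Real.sqrt ((2 * (ℓ * 2 ^ m) + r * 2 ^ m : ℕ) * ((r * 2 ^ m : ℕ) : ℝ)) / ((r * 2 ^ m : ℕ) : ℝ) * 1) ^ 2 / 2 +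
        (Real.sqrt ((2 * (ℓ * 2 ^ m) + r * 2 ^ m : ℕ) * ((r * 2 ^ m : ℕ) : ℝ)) / ((r * 2 ^ m : ℕ) : ℝ) * 1) ^ 2 / 2) ≤ Z) :
    ∑' k : Fin 2 → ℤ, (if ((Λ0 * 2 ^ 0 : ℕ) : ℤ) ≤ |k 0| ∧ (1 : ℤ) * |k 1| ≤ (v : ℤ) * |k 0| then (1 : ℝ) else 0) *
        ‖mFourierCoeff (fun x => (b j x : ℂ)) k‖ ^ 2 ≤
      (Real.sqrt (A + βs / 2) + Real.sqrt (ρs / 2 + Z) +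
          Real.sqrt (∑' k : Fin 2 → ℤ, (if (Y : ℤ) ≤ |k 0| ∧ (u' : ℤ) * |k 0| ≤ (v' : ℤ) * |k 1| then (1 : ℝ) else 0) *
            ‖mFourierCoeff (fun x => (a j x : ℂ)) k‖ ^ 2)) ^ 2 +
        ((1 + P.γ) ^ (2 * j) / ((Λ0 * 2 ^ Mb : ℕ) : ℝ)) ^ 2 := by
  have hmono : Monotone (fun m : ℕ => Λ0 * 2 ^ m) := fun m n h => Nat.mul_le_mul_left _ (Nat.pow_le_pow_right (by norm_num) h)
  have hΛ0' : 1 ≤ (fun m : ℕ => Λ0 * 2 ^ m) 0 := by simpa using hΛ0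
  have hR' : ∀ m : ℕ, 0 < (fun m : ℕ => r * 2 ^ m) m := fun m => Nat.mul_pos hr (Nat.two_pow_pos m)
  have hLR' : ∀ m : ℕ, 2 ≤ (fun m : ℕ => ℓ * 2 ^ m) m + (fun m : ℕ => r * 2 ^ m) m := fun m => by
    have h2 : 1 ≤ 2 ^ m := Nat.one_le_two_pow
    show 2 ≤ ℓ * 2 ^ m + r * 2 ^ m
    nlinarith
  have hΛQ' : ∀ m : ℕ, v * (fun m : ℕ => Λ0 * 2 ^ m) (m + 1) / 1 + ((fun m : ℕ => ℓ * 2 ^ m) m + (fun m : ℕ => r * 2 ^ m) m) + 1 ≤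
      (fun m : ℕ => Λ0 * 2 ^ m) m * G := fun m => by
    have h2 : 1 ≤ 2 ^ m := Nat.one_le_two_pow
    have h3 := Nat.mul_le_mul_right (2 ^ m) hΛQ
    show v * (Λ0 * 2 ^ (m + 1)) / 1 + (ℓ * 2 ^ m + r * 2 ^ m) + 1 ≤ Λ0 * 2 ^ m * G
    rw [Nat.div_one, pow_succ]
    nlinarith
  have hfeed' : ∀ m : ℕ, u' * (fun m : ℕ => Λ0 * 2 ^ m) (m + 1) ≤ v' * ((fun m : ℕ => ℓ * 2 ^ m) m + 1) := fun m => by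
    show u' * (Λ0 * 2 ^ (m + 1)) ≤ v' * (ℓ * 2 ^ m + 1)
    have h := Nat.mul_le_mul_right (2 ^ m) hfeed
    rw [pow_succ]
    nlinarith
  have hY' : Y ≤ (fun m : ℕ => Λ0 * 2 ^ m) 0 := by simpa using hY
  exact tsum_ratioClass_hstep_blocks_ctg_le P hγ hδ₀ hd hN₀ hρN a b has h0 hb hab j Nat.one_pos hv _ hmono hΛ0' Mb _ _ hR' hLR'
    hΛQ' hp hεg hM hMδ hε hfeed' hY' hβs hρs hA hβ hρ hZ

end Cascade

end Summit.AnomalousDissipation.AnomalousDissipation.Theorems.SawtoothPulseCascade.K1Window
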